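import Literature.Topology.PlaneTopology.WindingNumberCrossing
import HarnessLib

/-!
# The two lobes of a closed curve at a transversal double point cross an even number of times

Topic: Topology / PlaneTopology (companion to `WindingNumberCrossing.lean`). The abstract
winding-number argument behind **Gauss's parity condition** for the crossing sequence of a
closed normal plane curve (C. F. Gauss, *Werke* VIII, 272, 282–286; applied in
`Literature/Topology/FourManifolds` to the Gauss diagrams of knot projections):

* `even_card_crossings_of_lobes` — let `γ : ℝ → ℂ` be continuous, `a < b < a'`, with
  `γ a = γ b` (the **lobe** `L = γ [a, b]` is a loop) and `γ (a' - ε) = γ (a - ε)` (the curve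
  closes up: the second lobe `γ [b, a']` returns to the double point along the branch by which
  the first lobe is entered); suppose the double point `γ a` is transversal (independent
  velocities at `a` and `b`) and met by the first lobe only at its ends, and let the finite set
  `T ⊆ (b, a')` contain every time at which the second lobe meets the first, each such meeting
  being a transversal crossing at an interior parameter of the first lobe met only once. Then
  `T` has an even number of elements.

Proof: follow the winding number `W t = wind (L - γ t)` of the first lobe about the moving point
`γ t`, `t ∈ (b, a')`: it is locally constant off `T` (`wind_affine_sub_eq_of_path`), jumps by
`±1` at each time of `T` (`wind_sub_wind_of_hasDerivAt_cross'`), and takes the same value just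
after `b` and just before `a'` (`wind_sub_eq_of_corner`: at a transversal double point the two
outer branches lie in one complementary sector of the lobe). Hence `0 ≡ |T| (mod 2)`.

## References

* C. F. Gauss, *Werke*, Band VIII, Teubner (1900), pp. 272, 282–286 (Nachlass, zur Geometria
  situs: the crossing sequence of a closed plane curve is evenly intersticed).
* L. H. Kauffman, *Virtual knot theory*, European J. Combin. 20 (1999) 663–690, §2 (Gauss codes
  of planar curves are evenly intersticed). [cite: Kauffman1999, §2]
* L. V. Ahlfors, *Complex Analysis*, 3rd ed. (1979), §4.2.1 (winding numbers). [cite: Ahlfors1979, §4.2.1]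
-/

noncomputable section

open Complex Set Filter Topology
open scoped Real ComplexConjugate

namespace Literature.Topology.PlaneTopology

/-- Splitting a finite set of reals in an interval at an isolated element: the elements below
`t₀ - ε`, the element `t₀`, and the elements above `t₀ + ε`. [folklore] -/
theorem card_filter_Ioo_split (T : Finset ℝ) {u u' t₀ ε : ℝ} (ht₀ : t₀ ∈ T) (hut : u < t₀ - ε)
    (htu : t₀ + ε < u') (hε : 0 < ε) (hsep : ∀ t ∈ T, t ≠ t₀ → ε < |t - t₀|) :
    (T.filter fun t => u < t ∧ t < t₀ - ε).card + (T.filter fun t => t₀ + ε < t ∧ t < u').card + 1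
      = (T.filter fun t => u < t ∧ t < u').card := by
  classical
  set S := T.filter fun t => u < t ∧ t < u' with hS
  have hside : ∀ t ∈ T, t ≠ t₀ → t < t₀ - ε ∨ t₀ + ε < t := by
    intro t ht hne
    have h := hsep t ht hne
    rcases le_or_gt t t₀ with h1 | h1
    · left; rw [abs_of_nonpos (by linarith)] at h; linarith
    · right; rw [abs_of_pos (by linarith)] at h; linarith
  have h1 := Finset.card_filter_add_card_filter_not (s := S) (fun t => t < t₀)
  have h2 := Finset.card_filter_add_card_filter_not (s := S.filter fun t => ¬ t < t₀)
    (fun t => t₀ < t)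
  have eA : S.filter (fun t => t < t₀) = T.filter fun t => u < t ∧ t < t₀ - ε := by
    ext t
    simp only [hS, Finset.mem_filter]
    constructor
    · rintro ⟨⟨ht, hu1, -⟩, hlt⟩
      refine ⟨ht, hu1, ?_⟩
      rcases hside t ht hlt.ne with h | h
      · exact h
      · linarith
    · rintro ⟨ht, hu1, hlt⟩
      exact ⟨⟨ht, hu1, by linarith⟩, by linarith⟩
  have eB : (S.filter fun t => ¬ t < t₀).filter (fun t => t₀ < t)
      = T.filter fun t => t₀ + ε < t ∧ t < u' := by
    ext t
    simp only [hS, Finset.mem_filter]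
    constructor
    · rintro ⟨⟨⟨ht, -, hu2⟩, -⟩, hgt⟩
      refine ⟨ht, ?_, hu2⟩
      rcases hside t ht hgt.ne' with h | h
      · linarith
      · exact h
    · rintro ⟨ht, hgt, hu2⟩
      exact ⟨⟨⟨ht, by linarith, hu2⟩, by linarith⟩, by linarith⟩
  have eC : (S.filter fun t => ¬ t < t₀).filter (fun t => ¬ t₀ < t) = {t₀} := by
    ext t
    simp only [hS, Finset.mem_filter, Finset.mem_singleton]
    constructor
    · rintro ⟨⟨-, h1⟩, h2⟩
      linarith [not_lt.1 h1, not_lt.1 h2]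
    · rintro rfl
      exact ⟨⟨⟨ht₀, by linarith, by linarith⟩, lt_irrefl _⟩, lt_irrefl _⟩
  rw [eA] at h1
  rw [eB, eC, Finset.card_singleton] at h2
  omega

/-- **The two lobes of a closed curve at a transversal double point cross an even number of
times.** See the module docstring. [folklore] -/
theorem even_card_crossings_of_lobes {γ : ℝ → ℂ} {a b a' : ℝ} {v₁ v₂ : ℂ} (T : Finset ℝ)
    (hab : a < b) (hba' : b < a') (hγ : Continuous γ) (hloop : γ a = γ b)
    (hwrap : ∀ ε : ℝ, γ (a' - ε) = γ (a - ε))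
    (h₁ : HasDerivAt γ v₁ a) (h₂ : HasDerivAt γ v₂ b) (hD : (v₁ * conj v₂).im ≠ 0)
    (hcorner : ∀ s ∈ Icc a b, γ s = γ a → s = a ∨ s = b)
    (hT : ∀ t ∈ Ioo b a', γ t ∈ γ '' Icc a b → t ∈ T)
    (hT' : ∀ t ∈ T, t ∈ Ioo b a' ∧ ∃ s₀ ∈ Ioo a b, γ s₀ = γ t ∧
      (∀ s ∈ Icc a b, γ s = γ s₀ → s = s₀) ∧
      ∃ v w : ℂ, HasDerivAt γ v s₀ ∧ HasDerivAt γ w t ∧ (v * conj w).im ≠ 0) :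
    Even T.card := by
  classical
  set W : ℝ → ℤ := fun t => wind (fun τ => γ (a + τ * (b - a)) - γ t) with hW
  have hγon : ContinuousOn γ (Icc a b) := hγ.continuousOn
  -- the winding number along a stretch of the second lobe changes by the number of crossings
  have claim : ∀ (N : ℕ) (u u' : ℝ), b < u → u ≤ u' → u' < a' → γ u ∉ γ '' Icc a b →
      γ u' ∉ γ '' Icc a b → (T.filter fun t => u < t ∧ t < u').card = N →
      ∃ k : ℤ, W u' - W u = N + 2 * k := by
    intro N
    induction N using Nat.strong_induction_on with
    | _ N ih =>
      intro u u' hbu huu' hu'a hu hu' hcard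
      rcases (T.filter fun t => u < t ∧ t < u').eq_empty_or_nonempty with hemp | ⟨t₀, ht₀⟩
      · -- no crossing: the winding number is constant
        rw [hemp, Finset.card_empty] at hcard
        subst hcard
        refine ⟨0, ?_⟩
        have h := wind_affine_sub_eq_of_path hab.le hγon hloop huu' hγ.continuousOn
          (fun t ht => ?_)
        · change W u = W u' at h
          rw [h]; simp
        · rcases ht.1.eq_or_lt with h1 | h1
          · rw [← h1]; exact hu
          rcases ht.2.eq_or_lt with h2 | h2
          · rw [h2]; exact hu'
          intro himg
          have htT := hT t ⟨hbu.trans h1, h2.trans hu'a⟩ himg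
          have : t ∈ T.filter fun t => u < t ∧ t < u' := Finset.mem_filter.2 ⟨htT, h1, h2⟩
          rw [hemp] at this
          exact absurd this (Finset.notMem_empty t)
      · -- isolate the crossing `t₀`
        obtain ⟨ht₀T, hut₀, ht₀u'⟩ := Finset.mem_filter.1 ht₀
        obtain ⟨-, s₀, hs₀, hγs₀, hinj, v, w, hv, hw, hvw⟩ := hT' t₀ ht₀T
        have E1 := wind_sub_wind_of_hasDerivAt_cross' hγon hloop hs₀ hv hinj hw hγs₀.symm hvw
        have E2 : ∀ᶠ ε in 𝓝[>] (0 : ℝ), 1 * ε < t₀ - u := eventually_mul_lt_nhdsGT (by linarith)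
        have E3 : ∀ᶠ ε in 𝓝[>] (0 : ℝ), 1 * ε < u' - t₀ := eventually_mul_lt_nhdsGT (by linarith)
        have E4 : ∀ᶠ ε in 𝓝[>] (0 : ℝ), ∀ t ∈ T.erase t₀, 1 * ε < |t - t₀| := by
          rw [Filter.eventually_all_finset]
          intro t ht
          obtain ⟨hne, -⟩ := Finset.mem_erase.1 ht
          exact eventually_mul_lt_nhdsGT (abs_pos.2 (sub_ne_zero.2 hne))
        have E0 : ∀ᶠ ε in 𝓝[>] (0 : ℝ), 0 < ε := eventually_mem_nhdsWithin
        obtain ⟨ε, hε0, ⟨hγ₁, hγ₂, hjump⟩, hε2, hε3, hε4⟩ :=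
          (E0.and (E1.and (E2.and (E3.and E4)))).exists
        rw [one_mul] at hε2 hε3
        have hsep : ∀ t ∈ T, t ≠ t₀ → ε < |t - t₀| := fun t ht hne => by
          have := hε4 t (Finset.mem_erase.2 ⟨hne, ht⟩); rwa [one_mul] at this
        have hsplit := card_filter_Ioo_split T (u := u) (u' := u') ht₀T (by linarith)
          (by linarith) hε0 hsep
        rw [hcard] at hsplit
        set N₁ := (T.filter fun t => u < t ∧ t < t₀ - ε).card with hN₁
        set N₂ := (T.filter fun t => t₀ + ε < t ∧ t < u').card with hN₂
        obtain ⟨k₁, hk₁⟩ := ih N₁ (by omega) u (t₀ - ε) hbu (by linarith) (by linarith) hu hγ₁ rfl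
        obtain ⟨k₂, hk₂⟩ := ih N₂ (by omega) (t₀ + ε) u' (by linarith) (by linarith) hu'a hγ₂
          hu' rfl
        change (W (t₀ + ε) - W (t₀ - ε) = 1 ∨ W (t₀ + ε) - W (t₀ - ε) = -1) at hjump
        change W (t₀ - ε) - W u = N₁ + 2 * k₁ at hk₁
        change W u' - W (t₀ + ε) = N₂ + 2 * k₂ at hk₂
        have hN : (N : ℤ) = N₁ + N₂ + 1 := by exact_mod_cast hsplit.symm
        rcases hjump with hj | hj
        · exact ⟨k₁ + k₂, by linarith⟩
        · exact ⟨k₁ + k₂ - 1, by linarith⟩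
  -- the two ends of the second lobe
  have Ec := wind_sub_eq_of_corner hab hγon hloop h₁ h₂ hD hcorner
  have E5 : ∀ᶠ ε in 𝓝[>] (0 : ℝ), 2 * ε < a' - b := eventually_mul_lt_nhdsGT (by linarith)
  have E6 : ∀ᶠ ε in 𝓝[>] (0 : ℝ), ∀ t ∈ T, 1 * ε < min (t - b) (a' - t) := by
    rw [Filter.eventually_all_finset]
    intro t ht
    obtain ⟨⟨h1, h2⟩, -⟩ := hT' t ht
    exact eventually_mul_lt_nhdsGT (lt_min (by linarith) (by linarith))
  have E0 : ∀ᶠ ε in 𝓝[>] (0 : ℝ), 0 < ε := eventually_mem_nhdsWithin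
  obtain ⟨ε, hε0, ⟨hγb, hγa, hcorner_eq⟩, hε5, hε6⟩ := (E0.and (Ec.and (E5.and E6))).exists
  have hall : (T.filter fun t => b + ε < t ∧ t < a' - ε) = T := by
    refine Finset.filter_true_of_mem fun t ht => ?_
    have h := hε6 t ht
    rw [one_mul, lt_min_iff] at h
    constructor <;> linarith [h.1, h.2]
  have hγa' : γ (a' - ε) ∉ γ '' Icc a b := by rw [hwrap]; exact hγa
  obtain ⟨k, hk⟩ := claim T.card (b + ε) (a' - ε) (by linarith) (by linarith) (by linarith) hγb hγa'
    (by rw [hall])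
  change W (a' - ε) - W (b + ε) = T.card + 2 * k at hk
  have h0 : W (a' - ε) = W (b + ε) := by
    change wind (fun τ => γ (a + τ * (b - a)) - γ (a' - ε)) =
      wind (fun τ => γ (a + τ * (b - a)) - γ (b + ε))
    rw [hwrap, hcorner_eq]
  rw [h0, sub_self] at hk
  exact (Int.even_coe_nat _).1 ⟨-k, by linarith⟩

end Literature.Topology.PlaneTopology
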